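import Mathlib.Algebra.Module.SnakeLemma
import Literature.NumberTheory.EllipticCurves.SelmerCorankProofs
import HarnessLib

/-!
# Additivity of the `ℤ_p`-corank formula on short exact sequences; quasi-isomorphism invariance

Pure algebra for the corank formula `Literature.NumberTheory.EllipticCurves.zpCorank A p =
dim_{𝔽_p} A[p] − dim_{𝔽_p} A/pA` of file `Selmer` (meaningful for `p`-primary abelian groups `A`
with finite `p`-torsion, "cofinitely generated": Greenberg, LNM 1716 (1999), §1), complementing
§1 of `SelmerCorankProofs` (`zpCorank_congr`, `zpCorank_eq_add_of_exact` for a *divisible*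
subobject, `finite_modN_of_primary`). Everything here is proved:

* `natCard_torsionBy_snake` — the **snake lemma count** for multiplication by `p` on a short
  exact sequence `0 → A → B → C → 0`:
  `#A[p] · #C[p] · #(B/pB) = #B[p] · #(A/pA) · #(C/pC)` (Mathlib's `SnakeLemma.δ'`,
  `exact_δ'_right`, `exact_δ'_left` supply the connecting homomorphism `C[p] → A/pA`);
* `zpCorank_eq_add_of_shortExact` — **additivity**: for `B` `p`-primary with `B[p]` finite,
  `zpCorank B p = zpCorank A p + zpCorank C p` (the count read through `#X[p] = p^{dim}`,
  `#(X/pX) ≤ #X[p]`);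
* `zpCorank_eq_of_finite_ker_of_finite_coker`, `zpCorank_eq_of_nsmul_ker_of_nsmul_coker` —
  **quasi-isomorphism invariance**: a homomorphism of `p`-primary groups with finite `p`-torsion
  whose kernel and cokernel are finite (resp. killed by some `N ≠ 0`) preserves the corank;
* `zpCorank_prod` — `zpCorank (A × C) p = zpCorank A p + zpCorank C p`.

These are the elementary shadows of "corank is additive and an isogeny invariant" for cofinitely
generated `ℤ_p`-modules (Greenberg 1999, §1; used in Dokchitser–Dokchitser, Ann. of Math. 172
(2010), proof of Lemma 4.14: a map with kernel and cokernel killed by `|G|²` induces an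
isomorphism on `Hom(−, ℚ_p/ℤ_p) ⊗ ℚ_p`).

## References

* R. Greenberg, *Iwasawa theory for elliptic curves*, LNM 1716 (1999), §1. [Greenberg1999LNM]
* T. Dokchitser, V. Dokchitser, *On the Birch–Swinnerton-Dyer quotients modulo squares*,
  Ann. of Math. 172 (2010), Lemma 4.14 (proof). [DokchitserDokchitserAnnals2010]
-/

noncomputable section

open scoped AddSubgroup

open Function

namespace Literature.NumberTheory.EllipticCurves

section QuasiIso

variable {A B C : Type*} [AddCommGroup A] [AddCommGroup B] [AddCommGroup C] {p : ℕ}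

/-! ### Counting helpers -/

/-- `#X = #ker φ · #im φ` for a homomorphism of abelian groups (first isomorphism theorem).
[folklore] -/
theorem natCard_eq_card_ker_mul_card_range {X Y : Type*} [AddCommGroup X] [AddCommGroup Y]
    (φ : X →+ Y) : Nat.card X = Nat.card φ.ker * Nat.card φ.range := by
  rw [AddSubgroup.card_eq_card_quotient_mul_card_addSubgroup φ.ker,
    Nat.card_congr (QuotientAddGroup.quotientKerEquivRange φ).toEquiv, mul_comm]

/-- For a finite abelian group `A`, `#A[p] = #(A/pA)` (both equal `#A / #pA`). [folklore] -/
theorem natCard_torsionBy_eq_natCard_modN_of_finite [Finite A] (p : ℕ) :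
    Nat.card A[(p : ℤ)] = Nat.card (ModN A p) := by
  set φ : A →+ A := zsmulAddGroupHom (p : ℤ) with hφ
  have hker : φ.ker = A[(p : ℤ)] := AddSubgroup.ext fun x ↦ by
    simp [hφ, AddMonoidHom.mem_ker, Submodule.mem_torsionBy_iff]
  have hrange : φ.range = (LinearMap.range (LinearMap.lsmul ℤ A p)).toAddSubgroup :=
    AddSubgroup.ext fun x ↦ by simp [hφ, AddMonoidHom.mem_range, LinearMap.mem_range]
  have h1 := natCard_eq_card_ker_mul_card_range φ
  have h3 : Nat.card A = Nat.card (A ⧸ φ.range) * Nat.card φ.range :=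
    AddSubgroup.card_eq_card_quotient_mul_card_addSubgroup _
  have hcard : Nat.card φ.ker = Nat.card (A ⧸ φ.range) :=
    Nat.eq_of_mul_eq_mul_right Nat.card_pos (h1.symm.trans h3)
  rw [hker] at hcard
  rw [hcard, hrange]
  rfl

/-- For a finite abelian group the corank formula vanishes: `dim A[p] = dim A/pA`
(Greenberg 1999, §1: a finite `p`-primary group has `ℤ_p`-corank `0`). [folklore] -/
theorem zpCorank_of_finite_eq_zero [Finite A] (p : ℕ) [hp : Fact p.Prime] : zpCorank A p = 0 := by
  letI : Module (ZMod p) A[(p : ℤ)] := AddSubgroup.torsionBy.zmodModule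
  haveI : Finite (ModN A p) :=
    Finite.of_surjective _ (Submodule.mkQ_surjective (LinearMap.range (LinearMap.lsmul ℤ A p)))
  have e1 := pow_finrank_eq_natCard (p := p) (A[(p : ℤ)])
  have e2 := pow_finrank_eq_natCard (p := p) (ModN A p)
  have h : Module.finrank (ZMod p) A[(p : ℤ)] = Module.finrank (ZMod p) (ModN A p) :=
    Nat.pow_right_injective hp.out.two_le
      (e1.trans ((natCard_torsionBy_eq_natCard_modN_of_finite (A := A) p).trans e2.symm))
  unfold zpCorank
  omega

/-! ### Reduction modulo `p` of a homomorphism -/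

/-- The map `A/pA → B/pB` induced by `f : A → B`. [folklore] -/
def modNMap (f : A →+ B) (p : ℕ) : ModN A p →ₗ[ℤ] ModN B p :=
  Submodule.mapQ _ _ f.toIntLinearMap (by
    rintro _ ⟨a, rfl⟩
    exact ⟨f a, by simp⟩)

/-- `modNMap f p [a] = [f a]`. [folklore] -/
@[simp]
theorem modNMap_mkQ (f : A →+ B) (p : ℕ) (a : A) :
    modNMap f p (ModN.mkQ p a) = ModN.mkQ p (f a) :=
  rfl

/-- `mkQ a = 0` in `A/pA` iff `a ∈ pA`. [folklore] -/
theorem mkQ_eq_zero_iff (p : ℕ) (a : A) : ModN.mkQ p a = 0 ↔ ∃ a' : A, (p : ℤ) • a' = a := by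
  change Submodule.Quotient.mk a = (0 : ModN A p) ↔ _
  rw [Submodule.Quotient.mk_eq_zero, LinearMap.mem_range]
  simp only [LinearMap.lsmul_apply]

/-- `A/pA → B/pB` is onto when `A → B` is. [folklore] -/
theorem modNMap_surjective {f : A →+ B} (hf : Surjective f) (p : ℕ) :
    Surjective (modNMap f p) := by
  intro q
  obtain ⟨b, rfl⟩ := Submodule.mkQ_surjective _ q
  obtain ⟨a, rfl⟩ := hf b
  exact ⟨ModN.mkQ p a, rfl⟩

/-- Right exactness of `− ⊗ ℤ/p`: along `A → B → C → 0` exact, the kernel of `B/pB → C/pC` is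
the image of `A/pA`. [folklore] -/
theorem ker_modNMap_eq_range {i : A →+ B} {f : B →+ C} (hf : Surjective f)
    (hex : ∀ b, f b = 0 → b ∈ i.range) (hfi : ∀ a, f (i a) = 0) :
    LinearMap.ker (modNMap f p) = LinearMap.range (modNMap i p) := by
  ext q
  obtain ⟨b, rfl⟩ := Submodule.mkQ_surjective _ q
  rw [LinearMap.mem_ker, LinearMap.mem_range]
  change modNMap f p (ModN.mkQ p b) = 0 ↔ ∃ y, modNMap i p y = ModN.mkQ p b
  constructor
  · rw [modNMap_mkQ, mkQ_eq_zero_iff]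
    rintro ⟨c, hc⟩
    obtain ⟨b', rfl⟩ := hf c
    have h0 : f (b - (p : ℤ) • b') = 0 := by rw [map_sub, map_zsmul, hc, sub_self]
    obtain ⟨a, ha⟩ := hex _ h0
    refine ⟨ModN.mkQ p a, ?_⟩
    rw [modNMap_mkQ, ha, map_sub, sub_eq_self, mkQ_eq_zero_iff]
    exact ⟨b', rfl⟩
  · rintro ⟨q', hq'⟩
    obtain ⟨a, rfl⟩ := Submodule.mkQ_surjective _ q'
    rw [← hq']
    change modNMap f p (modNMap i p (ModN.mkQ p a)) = 0
    rw [modNMap_mkQ, modNMap_mkQ, hfi, map_zero]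

/-! ### Sub- and quotient groups of a `p`-primary group with finite `p`-torsion -/

/-- A subgroup of a `p`-primary group with finite `p`-torsion is `p`-primary with finite
`p`-torsion. [folklore] -/
theorem primary_and_finite_torsionBy_of_injective {i : A →+ B} (hi : Injective i)
    (hB : ∀ b : B, ∃ n : ℕ, p ^ n • b = 0) [Finite B[(p : ℤ)]] :
    (∀ a : A, ∃ n : ℕ, p ^ n • a = 0) ∧ Finite A[(p : ℤ)] := by
  refine ⟨fun a ↦ ?_, Finite.of_injective _ (torsionByMap_injective hi p)⟩
  obtain ⟨n, hn⟩ := hB (i a)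
  exact ⟨n, hi (by rw [map_nsmul, hn, map_zero])⟩

/-- In an abelian group, `N • a = 0` and `p ^ n • a = 0` with `N ≠ 0` force `p ^ N • a = 0`
(the order of `a` is a power of `p` dividing `N`, hence at most `p ^ N`). [folklore] -/
theorem pow_smul_eq_zero_of_nsmul_eq_zero (hp : p.Prime) {a : A} {N n : ℕ} (hN : N ≠ 0)
    (hNa : N • a = 0) (hna : p ^ n • a = 0) : p ^ N • a = 0 := by
  have h1 : addOrderOf a ∣ N := addOrderOf_dvd_of_nsmul_eq_zero hNa
  have h2 : addOrderOf a ∣ p ^ n := addOrderOf_dvd_of_nsmul_eq_zero hna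
  obtain ⟨i, -, hi⟩ := (Nat.dvd_prime_pow hp).mp h2
  have hle : p ^ i ≤ N := Nat.le_of_dvd (Nat.pos_of_ne_zero hN) (hi ▸ h1)
  have hiN : i ≤ N := ((Nat.lt_pow_self hp.one_lt).le.trans hle)
  obtain ⟨k, hk⟩ := Nat.exists_eq_add_of_le hiN
  rw [hk, pow_add, mul_comm, ← smul_smul, ← hi, addOrderOf_nsmul_eq_zero, smul_zero]

variable (A) in
/-- In a `p`-primary group with finite `p`-torsion, every `A[N]` (`N ≠ 0`) is finite
(`A[N] ⊆ A[p^N]`). [folklore] -/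
theorem finite_torsionBy_of_primary (hp : p.Prime) (hA : ∀ a : A, ∃ n : ℕ, p ^ n • a = 0)
    [Finite A[(p : ℤ)]] {N : ℕ} (hN : N ≠ 0) : Finite A[(N : ℤ)] := by
  haveI := finite_torsionBy_pow A p N
  refine Finite.of_injective (fun x : A[(N : ℤ)] ↦ (⟨(x : A), ?_⟩ : A[((p ^ N : ℕ) : ℤ)])) ?_
  · obtain ⟨n, hn⟩ := hA x
    exact AddSubgroup.torsionBy.nsmul_iff.mpr
      (pow_smul_eq_zero_of_nsmul_eq_zero hp hN (AddSubgroup.torsionBy.nsmul_iff.mp x.2) hn)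
  · intro x y hxy
    exact Subtype.ext (congrArg (fun z : A[((p ^ N : ℕ) : ℤ)] ↦ (z : A)) hxy)

/-- A `p`-primary group with finite `p`-torsion which is killed by some `N ≠ 0` is finite.
[folklore] -/
theorem finite_of_primary_of_nsmul_eq_zero (hp : p.Prime) (hA : ∀ a : A, ∃ n : ℕ, p ^ n • a = 0)
    [Finite A[(p : ℤ)]] {N : ℕ} (hN : N ≠ 0) (h : ∀ a : A, N • a = 0) : Finite A := by
  haveI := finite_torsionBy_of_primary A hp hA hN
  exact Finite.of_injective (fun a : A ↦ (⟨a, AddSubgroup.torsionBy.nsmul_iff.mpr (h a)⟩ :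
    A[(N : ℤ)])) fun x y hxy ↦ congrArg (fun z : A[(N : ℤ)] ↦ (z : A)) hxy

/-! ### The snake lemma count -/

/-- The `p`-torsion subgroup is the kernel of multiplication by `p`, as an exactness statement for
Mathlib's `Function.Exact`. [folklore] -/
theorem exact_subtype_torsionBy_lsmul (p : ℕ) :
    Function.Exact (A[(p : ℤ)]).subtype.toIntLinearMap (LinearMap.lsmul ℤ A p) := by
  intro a
  simp only [LinearMap.lsmul_apply, AddMonoidHom.coe_toIntLinearMap, AddSubgroup.coe_subtype,
    Set.mem_range, Subtype.exists, exists_prop, exists_eq_right]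
  exact (Submodule.mem_torsionBy_iff (p : ℤ) a).symm

/-- **The snake lemma count for multiplication by `p`.** For a short exact sequence
`0 → A → B → C → 0` of abelian groups all of whose `p`-torsion subgroups and mod-`p` quotients
are finite, `#A[p] · #C[p] · #(B/pB) = #B[p] · #(A/pA) · #(C/pC)`: the alternating product of
the orders in the six-term exact sequence
`0 → A[p] → B[p] → C[p] → A/pA → B/pB → C/pC → 0` is `1`. [folklore] -/
theorem natCard_torsionBy_snake {i : A →+ B} {f : B →+ C} (hi : Injective i)
    (hf : Surjective f) (hex : ∀ b, f b = 0 → b ∈ i.range) (hfi : ∀ a, f (i a) = 0)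
    [Finite A[(p : ℤ)]] [Finite B[(p : ℤ)]] [Finite C[(p : ℤ)]]
    [Finite (ModN A p)] [Finite (ModN B p)] [Finite (ModN C p)] :
    Nat.card A[(p : ℤ)] * Nat.card C[(p : ℤ)] * Nat.card (ModN B p) =
      Nat.card B[(p : ℤ)] * Nat.card (ModN A p) * Nat.card (ModN C p) := by
  -- the rows
  let iₗ : A →ₗ[ℤ] B := i.toIntLinearMap
  let fₗ : B →ₗ[ℤ] C := f.toIntLinearMap
  have hexl : Function.Exact iₗ fₗ := fun b ↦
    ⟨fun h ↦ by obtain ⟨a, rfl⟩ := hex b h; exact ⟨a, rfl⟩, by rintro ⟨a, rfl⟩; exact hfi a⟩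
  have hfₗ : Surjective fₗ := hf
  have hiₗ : Injective iₗ := hi
  -- the vertical maps (multiplication by `p`) and the commuting squares
  let mA : A →ₗ[ℤ] A := LinearMap.lsmul ℤ A p
  let mB : B →ₗ[ℤ] B := LinearMap.lsmul ℤ B p
  let mC : C →ₗ[ℤ] C := LinearMap.lsmul ℤ C p
  have h₁ : iₗ.comp mA = mB.comp iₗ := LinearMap.ext fun a ↦ by simp [iₗ, mA, mB]
  have h₂ : fₗ.comp mB = mC.comp fₗ := LinearMap.ext fun b ↦ by simp [fₗ, mB, mC]
  -- kernels and cokernels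
  let ι₂ : B[(p : ℤ)] →ₗ[ℤ] B := (B[(p : ℤ)]).subtype.toIntLinearMap
  let ι₃ : C[(p : ℤ)] →ₗ[ℤ] C := (C[(p : ℤ)]).subtype.toIntLinearMap
  have hι₂ : Function.Exact ι₂ mB := exact_subtype_torsionBy_lsmul p
  have hι₃ : Function.Exact ι₃ mC := exact_subtype_torsionBy_lsmul p
  have hι₃inj : Injective ι₃ := Subtype.val_injective
  let π₁ : A →ₗ[ℤ] ModN A p := (LinearMap.range mA).mkQ
  let π₂ : B →ₗ[ℤ] ModN B p := (LinearMap.range mB).mkQ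
  have hπ₁ : Function.Exact mA π₁ := LinearMap.exact_map_mkQ_range mA
  have hπ₂ : Function.Exact mB π₂ := LinearMap.exact_map_mkQ_range mB
  have hπ₁surj : Surjective π₁ := Submodule.mkQ_surjective _
  let F : B[(p : ℤ)] →ₗ[ℤ] C[(p : ℤ)] := (torsionByMap f p).toIntLinearMap
  have hF : fₗ.comp ι₂ = ι₃.comp F := LinearMap.ext fun _ ↦ rfl
  let G : ModN A p →ₗ[ℤ] ModN B p := modNMap i p
  have hG : G.comp π₁ = π₂.comp iₗ := LinearMap.ext fun _ ↦ rfl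
  -- the connecting homomorphism and the two exactness statements of the snake lemma
  let δ : C[(p : ℤ)] →ₗ[ℤ] ModN A p :=
    SnakeLemma.δ' mA mB mC iₗ fₗ hexl iₗ fₗ hexl h₁ h₂ ι₃ hι₃ π₁ hπ₁ hfₗ hiₗ
  have hδr : Function.Exact F δ :=
    SnakeLemma.exact_δ'_right mA mB mC iₗ fₗ hexl iₗ fₗ hexl h₁ h₂ ι₂ hι₂ ι₃ hι₃ π₁ hπ₁ hfₗ hiₗ
      F hF hι₃inj
  have hδl : Function.Exact δ G :=
    SnakeLemma.exact_δ'_left mA mB mC iₗ fₗ hexl iₗ fₗ hexl h₁ h₂ ι₃ hι₃ π₁ hπ₁ π₂ hπ₂ hfₗ hiₗ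
      G hG hπ₁surj
  -- read them as equalities of subgroups
  have e1 : (torsionByMap f p).ker = (torsionByMap i p).range :=
    ker_torsionByMap_eq_range hi hex hfi
  have e2 : δ.toAddMonoidHom.ker = (torsionByMap f p).range := by
    ext x
    rw [AddMonoidHom.mem_ker, LinearMap.toAddMonoidHom_coe, AddMonoidHom.mem_range]
    exact hδr x
  have e3 : G.toAddMonoidHom.ker = δ.toAddMonoidHom.range := by
    ext x
    rw [AddMonoidHom.mem_ker, LinearMap.toAddMonoidHom_coe, AddMonoidHom.mem_range]
    exact hδl x
  have e4 : (modNMap f p).toAddMonoidHom.ker = G.toAddMonoidHom.range := by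
    ext x
    rw [AddMonoidHom.mem_ker, LinearMap.toAddMonoidHom_coe, AddMonoidHom.mem_range,
      ← LinearMap.mem_ker, ker_modNMap_eq_range (p := p) hf hex hfi, LinearMap.mem_range]
    rfl
  have e5 : (modNMap f p).toAddMonoidHom.range = ⊤ :=
    AddMonoidHom.range_eq_top.mpr (modNMap_surjective hf p)
  -- count
  have cA : Nat.card A[(p : ℤ)] = Nat.card (torsionByMap i p).range :=
    Nat.card_congr (AddMonoidHom.ofInjective (torsionByMap_injective hi p)).toEquiv
  have cB := natCard_eq_card_ker_mul_card_range (torsionByMap f p)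
  have cC := natCard_eq_card_ker_mul_card_range δ.toAddMonoidHom
  have cA' := natCard_eq_card_ker_mul_card_range G.toAddMonoidHom
  have cB' := natCard_eq_card_ker_mul_card_range (modNMap f p).toAddMonoidHom
  rw [e1, ← cA] at cB
  rw [e2] at cC
  rw [e3] at cA'
  rw [e4, e5, AddSubgroup.card_top] at cB'
  change Nat.card C[(p : ℤ)] = _ at cC
  change Nat.card (ModN A p) = _ at cA'
  change Nat.card (ModN B p) = _ * Nat.card (ModN C p) at cB'
  rw [cB, cC, cA', cB']
  ring

/-- Along a short exact sequence `0 → A → B → C → 0` with `B` `p`-primary and `B[p]` finite,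
`C[p]` is finite: by the snake lemma `C[p] / im B[p]` embeds in the finite group `A/pA`.
[folklore] -/
theorem finite_torsionBy_of_shortExact {i : A →+ B} {f : B →+ C} (hi : Injective i)
    (hf : Surjective f) (hex : ∀ b, f b = 0 → b ∈ i.range) (hfi : ∀ a, f (i a) = 0)
    (hB : ∀ b : B, ∃ n : ℕ, p ^ n • b = 0) [Finite B[(p : ℤ)]] : Finite C[(p : ℤ)] := by
  obtain ⟨hA, hAfin⟩ := primary_and_finite_torsionBy_of_injective hi hB
  haveI := hAfin
  obtain ⟨hAm, -⟩ := finite_modN_of_primary hA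
  haveI := hAm
  let iₗ : A →ₗ[ℤ] B := i.toIntLinearMap
  let fₗ : B →ₗ[ℤ] C := f.toIntLinearMap
  have hexl : Function.Exact iₗ fₗ := fun b ↦
    ⟨fun h ↦ by obtain ⟨a, rfl⟩ := hex b h; exact ⟨a, rfl⟩, by rintro ⟨a, rfl⟩; exact hfi a⟩
  have hfₗ : Surjective fₗ := hf
  have hiₗ : Injective iₗ := hi
  let mA : A →ₗ[ℤ] A := LinearMap.lsmul ℤ A p
  let mB : B →ₗ[ℤ] B := LinearMap.lsmul ℤ B p
  let mC : C →ₗ[ℤ] C := LinearMap.lsmul ℤ C p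
  have h₁ : iₗ.comp mA = mB.comp iₗ := LinearMap.ext fun a ↦ by simp [iₗ, mA, mB]
  have h₂ : fₗ.comp mB = mC.comp fₗ := LinearMap.ext fun b ↦ by simp [fₗ, mB, mC]
  let ι₂ : B[(p : ℤ)] →ₗ[ℤ] B := (B[(p : ℤ)]).subtype.toIntLinearMap
  let ι₃ : C[(p : ℤ)] →ₗ[ℤ] C := (C[(p : ℤ)]).subtype.toIntLinearMap
  have hι₂ : Function.Exact ι₂ mB := exact_subtype_torsionBy_lsmul p
  have hι₃ : Function.Exact ι₃ mC := exact_subtype_torsionBy_lsmul p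
  have hι₃inj : Injective ι₃ := Subtype.val_injective
  let π₁ : A →ₗ[ℤ] ModN A p := (LinearMap.range mA).mkQ
  have hπ₁ : Function.Exact mA π₁ := LinearMap.exact_map_mkQ_range mA
  let F : B[(p : ℤ)] →ₗ[ℤ] C[(p : ℤ)] := (torsionByMap f p).toIntLinearMap
  have hF : fₗ.comp ι₂ = ι₃.comp F := LinearMap.ext fun _ ↦ rfl
  let δ : C[(p : ℤ)] →ₗ[ℤ] ModN A p :=
    SnakeLemma.δ' mA mB mC iₗ fₗ hexl iₗ fₗ hexl h₁ h₂ ι₃ hι₃ π₁ hπ₁ hfₗ hiₗ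
  have hδr : Function.Exact F δ :=
    SnakeLemma.exact_δ'_right mA mB mC iₗ fₗ hexl iₗ fₗ hexl h₁ h₂ ι₂ hι₂ ι₃ hι₃ π₁ hπ₁ hfₗ hiₗ
      F hF hι₃inj
  have e2 : δ.toAddMonoidHom.ker = (torsionByMap f p).range := by
    ext x
    rw [AddMonoidHom.mem_ker, LinearMap.toAddMonoidHom_coe, AddMonoidHom.mem_range]
    exact hδr x
  haveI : Finite (torsionByMap f p).range :=
    Finite.of_surjective _ (torsionByMap f p).rangeRestrict_surjective
  haveI : Finite δ.toAddMonoidHom.ker := by rw [e2]; infer_instance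
  haveI : Finite δ.toAddMonoidHom.range := Subtype.finite
  haveI : Finite (C[(p : ℤ)] ⧸ δ.toAddMonoidHom.ker) :=
    Finite.of_equiv _ (QuotientAddGroup.quotientKerEquivRange δ.toAddMonoidHom).symm.toEquiv
  exact Finite.of_addSubgroup_quotient δ.toAddMonoidHom.ker

/-! ### Additivity of the corank formula -/

/-- `#A[p] = p ^ zpCorank A p · #(A/pA)` for a `p`-primary group with finite `p`-torsion
(`#(A/pA) ≤ #A[p]`, both powers of `p`). [folklore] -/
theorem pow_zpCorank_mul_natCard_modN [hp : Fact p.Prime] (hA : ∀ a : A, ∃ n : ℕ, p ^ n • a = 0)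
    [Finite A[(p : ℤ)]] : p ^ zpCorank A p * Nat.card (ModN A p) = Nat.card A[(p : ℤ)] := by
  letI : Module (ZMod p) A[(p : ℤ)] := AddSubgroup.torsionBy.zmodModule
  obtain ⟨hfin, hle⟩ := finite_modN_of_primary hA
  haveI := hfin
  rw [← pow_finrank_eq_natCard (p := p) (A[(p : ℤ)]), ← pow_finrank_eq_natCard (p := p) (ModN A p)]
    at hle ⊢
  have hle' := (Nat.pow_le_pow_iff_right hp.out.one_lt).mp hle
  rw [← pow_add]
  unfold zpCorank
  congr 1
  omega

/-- **Additivity of the `ℤ_p`-corank formula on short exact sequences.** If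
`0 → A → B → C → 0` is exact and `B` is `p`-primary with `B[p]` finite (so that `A`, `C` are
`p`-primary with finite `p`-torsion too), then `zpCorank B p = zpCorank A p + zpCorank C p`.
(For cofinitely generated `ℤ_p`-modules this is the additivity of coranks, Greenberg 1999, §1;
here it is the snake lemma count `natCard_torsionBy_snake` read through `#X[p] = p^{dim X[p]}`.)
[folklore] -/
theorem zpCorank_eq_add_of_shortExact [hp : Fact p.Prime] {i : A →+ B} {f : B →+ C}
    (hi : Injective i) (hf : Surjective f) (hex : ∀ b, f b = 0 → b ∈ i.range)
    (hfi : ∀ a, f (i a) = 0) (hB : ∀ b : B, ∃ n : ℕ, p ^ n • b = 0) [Finite B[(p : ℤ)]] :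
    zpCorank B p = zpCorank A p + zpCorank C p := by
  -- finiteness of the six terms
  obtain ⟨hA, hAfin⟩ := primary_and_finite_torsionBy_of_injective hi hB
  haveI := hAfin
  have hC : ∀ c : C, ∃ n : ℕ, p ^ n • c = 0 := fun c ↦ by
    obtain ⟨b, rfl⟩ := hf c
    obtain ⟨n, hn⟩ := hB b
    exact ⟨n, by rw [← map_nsmul, hn, map_zero]⟩
  obtain ⟨hAm, -⟩ := finite_modN_of_primary hA
  obtain ⟨hBm, -⟩ := finite_modN_of_primary hB
  haveI := hAm
  haveI := hBm
  haveI : Finite (ModN C p) := Finite.of_surjective _ (modNMap_surjective hf p)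
  haveI : Finite C[(p : ℤ)] := finite_torsionBy_of_shortExact hi hf hex hfi hB
  -- dimensions
  letI : Module (ZMod p) A[(p : ℤ)] := AddSubgroup.torsionBy.zmodModule
  letI : Module (ZMod p) B[(p : ℤ)] := AddSubgroup.torsionBy.zmodModule
  letI : Module (ZMod p) C[(p : ℤ)] := AddSubgroup.torsionBy.zmodModule
  have count := natCard_torsionBy_snake (p := p) hi hf hex hfi
  have kA := pow_zpCorank_mul_natCard_modN (p := p) hA
  have kB := pow_zpCorank_mul_natCard_modN (p := p) hB
  have kC := pow_zpCorank_mul_natCard_modN (p := p) hC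
  rw [← kA, ← kB, ← kC] at count
  rw [← pow_finrank_eq_natCard (p := p) (ModN A p), ← pow_finrank_eq_natCard (p := p) (ModN B p),
    ← pow_finrank_eq_natCard (p := p) (ModN C p)] at count
  simp only [← pow_add] at count
  have := Nat.pow_right_injective hp.out.two_le count
  omega

/-- Corank is unchanged by a finite kernel: `0 → A → B → C → 0` exact with `A` finite and `B`
`p`-primary with finite `p`-torsion gives `zpCorank B p = zpCorank C p`. [folklore] -/
theorem zpCorank_eq_of_shortExact_of_finite_left [Fact p.Prime] {i : A →+ B} {f : B →+ C}
    (hi : Injective i) (hf : Surjective f) (hex : ∀ b, f b = 0 → b ∈ i.range)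
    (hfi : ∀ a, f (i a) = 0) (hB : ∀ b : B, ∃ n : ℕ, p ^ n • b = 0) [Finite B[(p : ℤ)]]
    [Finite A] : zpCorank B p = zpCorank C p := by
  rw [zpCorank_eq_add_of_shortExact hi hf hex hfi hB, zpCorank_of_finite_eq_zero (A := A),
    zero_add]

/-- Corank is unchanged by a finite cokernel: `0 → A → B → C → 0` exact with `C` finite and `B`
`p`-primary with finite `p`-torsion gives `zpCorank A p = zpCorank B p`. [folklore] -/
theorem zpCorank_eq_of_shortExact_of_finite_right [Fact p.Prime] {i : A →+ B} {f : B →+ C}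
    (hi : Injective i) (hf : Surjective f) (hex : ∀ b, f b = 0 → b ∈ i.range)
    (hfi : ∀ a, f (i a) = 0) (hB : ∀ b : B, ∃ n : ℕ, p ^ n • b = 0) [Finite B[(p : ℤ)]]
    [Finite C] : zpCorank A p = zpCorank B p := by
  rw [zpCorank_eq_add_of_shortExact hi hf hex hfi hB, zpCorank_of_finite_eq_zero (A := C),
    add_zero]

/-! ### Quasi-isomorphism invariance -/

/-- **A homomorphism with finite kernel and finite cokernel preserves the corank** (for
`p`-primary groups with finite `p`-torsion). Greenberg 1999, §1; Dokchitser–Dokchitser 2010,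
proof of Lemma 4.14. [folklore] -/
theorem zpCorank_eq_of_finite_ker_of_finite_coker [Fact p.Prime] (f : A →+ B)
    (hA : ∀ a : A, ∃ n : ℕ, p ^ n • a = 0) (hB : ∀ b : B, ∃ n : ℕ, p ^ n • b = 0)
    [Finite A[(p : ℤ)]] [Finite B[(p : ℤ)]] [Finite f.ker] [Finite (B ⧸ f.range)] :
    zpCorank A p = zpCorank B p := by
  -- `0 → ker f → A → im f → 0`
  have h1 : zpCorank A p = zpCorank f.range p :=
    zpCorank_eq_of_shortExact_of_finite_left (i := f.ker.subtype) (f := f.rangeRestrict)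
      Subtype.val_injective f.rangeRestrict_surjective
      (fun a ha ↦ ⟨⟨a, by simpa using congrArg (fun z : f.range ↦ (z : B)) ha⟩, rfl⟩)
      (fun a ↦ Subtype.ext a.2) hA
  -- `0 → im f → B → B / im f → 0`
  have h2 : zpCorank f.range p = zpCorank B p :=
    zpCorank_eq_of_shortExact_of_finite_right (i := f.range.subtype)
      (f := QuotientAddGroup.mk' f.range) Subtype.val_injective (QuotientAddGroup.mk'_surjective _)
      (fun b hb ↦ by
        rw [QuotientAddGroup.mk'_apply, QuotientAddGroup.eq_zero_iff] at hb
        exact ⟨⟨b, hb⟩, rfl⟩)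
      (fun x ↦ by rw [QuotientAddGroup.mk'_apply, QuotientAddGroup.eq_zero_iff]; exact x.2) hB
  exact h1.trans h2

/-- **A homomorphism whose kernel and cokernel are killed by some `N ≠ 0` preserves the corank**
(for `p`-primary groups with finite `p`-torsion): such kernel and cokernel are finite. This is
the form used in Dokchitser–Dokchitser 2010, proof of Lemma 4.14 ("kernel and cokernel killed
by `|G|²`"). [cite: DokchitserDokchitserAnnals2010, Lemma 4.14 (proof)] -/
theorem zpCorank_eq_of_nsmul_ker_of_nsmul_coker [hp : Fact p.Prime] (f : A →+ B)
    (hA : ∀ a : A, ∃ n : ℕ, p ^ n • a = 0) (hB : ∀ b : B, ∃ n : ℕ, p ^ n • b = 0)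
    [Finite A[(p : ℤ)]] [Finite B[(p : ℤ)]] {N : ℕ} (hN : N ≠ 0)
    (hker : ∀ a, f a = 0 → N • a = 0) (hcoker : ∀ b, N • b ∈ f.range) :
    zpCorank A p = zpCorank B p := by
  -- the kernel is finite
  haveI : Finite f.ker := by
    haveI := finite_torsionBy_of_primary A hp.out hA hN
    refine Finite.of_injective (fun x : f.ker ↦ (⟨(x : A), AddSubgroup.torsionBy.nsmul_iff.mpr
      (hker x x.2)⟩ : A[(N : ℤ)])) ?_
    intro x y hxy
    exact Subtype.ext (congrArg (fun z : A[(N : ℤ)] ↦ (z : A)) hxy)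
  -- the cokernel is `p`-primary with finite `p`-torsion, killed by `N`, hence finite
  haveI : Finite (B ⧸ f.range) := by
    set Q := B ⧸ f.range
    have hQ : ∀ q : Q, ∃ n : ℕ, p ^ n • q = 0 := fun q ↦ by
      induction q using QuotientAddGroup.induction_on with
      | H b =>
        obtain ⟨n, hn⟩ := hB b
        exact ⟨n, by rw [← QuotientAddGroup.mk_nsmul, hn, QuotientAddGroup.mk_zero]⟩
    haveI : Finite f.range[(p : ℤ)] :=
      (primary_and_finite_torsionBy_of_injective (i := f.range.subtype) Subtype.val_injective hB).2
    -- `Q[p]` is finite: additivity along `0 → im f → B → Q → 0` needs it, and proves it en route;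
    -- we extract it from `zpCorank_eq_add_of_shortExact`'s sibling count directly:
    haveI : Finite Q[(p : ℤ)] := by
      have hexQ : ∀ b, QuotientAddGroup.mk' f.range b = 0 → b ∈ f.range.subtype.range := fun b hb ↦ by
        rw [QuotientAddGroup.mk'_apply, QuotientAddGroup.eq_zero_iff] at hb
        exact ⟨⟨b, hb⟩, rfl⟩
      have hfiQ : ∀ x : f.range, QuotientAddGroup.mk' f.range (f.range.subtype x) = 0 := fun x ↦ by
        rw [QuotientAddGroup.mk'_apply, QuotientAddGroup.eq_zero_iff]; exact x.2
      exact finite_torsionBy_of_shortExact Subtype.val_injective (QuotientAddGroup.mk'_surjective _)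
        hexQ hfiQ hB
    exact finite_of_primary_of_nsmul_eq_zero hp.out hQ hN fun q ↦ by
      induction q using QuotientAddGroup.induction_on with
      | H b =>
        rw [← QuotientAddGroup.mk_nsmul, QuotientAddGroup.eq_zero_iff]
        exact hcoker b
  exact zpCorank_eq_of_finite_ker_of_finite_coker f hA hB

/-! ### Products -/

/-- An extension of `p`-primary groups with finite `p`-torsion is `p`-primary with finite
`p`-torsion. [folklore] -/
theorem primary_and_finite_torsionBy_of_shortExact {i : A →+ B} {f : B →+ C} (hi : Injective i)
    (hex : ∀ b, f b = 0 → b ∈ i.range) (hfi : ∀ a, f (i a) = 0)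
    (hA : ∀ a : A, ∃ n : ℕ, p ^ n • a = 0) (hC : ∀ c : C, ∃ n : ℕ, p ^ n • c = 0)
    [Finite A[(p : ℤ)]] [Finite C[(p : ℤ)]] :
    (∀ b : B, ∃ n : ℕ, p ^ n • b = 0) ∧ Finite B[(p : ℤ)] := by
  refine ⟨fun b ↦ ?_, ?_⟩
  · obtain ⟨n, hn⟩ := hC (f b)
    obtain ⟨a, ha⟩ := hex (p ^ n • b) (by rw [map_nsmul, hn])
    obtain ⟨m, hm⟩ := hA a
    exact ⟨m + n, by rw [pow_add, mul_smul, ← ha, ← map_nsmul, hm, map_zero]⟩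
  · haveI : Finite (torsionByMap i p).range :=
      Finite.of_surjective _ (torsionByMap i p).rangeRestrict_surjective
    haveI : Finite (torsionByMap f p).ker := by
      rw [ker_torsionByMap_eq_range hi hex hfi]; infer_instance
    haveI : Finite (torsionByMap f p).range := Subtype.finite
    haveI : Finite (B[(p : ℤ)] ⧸ (torsionByMap f p).ker) :=
      Finite.of_equiv _ (QuotientAddGroup.quotientKerEquivRange (torsionByMap f p)).symm.toEquiv
    exact Finite.of_addSubgroup_quotient (torsionByMap f p).ker

/-- **`zpCorank (A × C) p = zpCorank A p + zpCorank C p`** for `p`-primary groups with finite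
`p`-torsion (additivity along `0 → A → A × C → C → 0`). [folklore] -/
theorem zpCorank_prod [Fact p.Prime] (hA : ∀ a : A, ∃ n : ℕ, p ^ n • a = 0)
    (hC : ∀ c : C, ∃ n : ℕ, p ^ n • c = 0) [Finite A[(p : ℤ)]] [Finite C[(p : ℤ)]] :
    zpCorank (A × C) p = zpCorank A p + zpCorank C p := by
  have hi : Injective (AddMonoidHom.inl A C) := fun a b h ↦ (Prod.ext_iff.mp h).1
  have hf : Surjective (AddMonoidHom.snd A C) := fun c ↦ ⟨(0, c), rfl⟩
  have hex : ∀ b : A × C, AddMonoidHom.snd A C b = 0 → b ∈ (AddMonoidHom.inl A C).range :=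
    fun b hb ↦ ⟨b.1, Prod.ext rfl (by simpa using hb.symm)⟩
  have hfi : ∀ a : A, AddMonoidHom.snd A C (AddMonoidHom.inl A C a) = 0 := fun _ ↦ rfl
  obtain ⟨hB, hBfin⟩ := primary_and_finite_torsionBy_of_shortExact hi hex hfi hA hC
  haveI := hBfin
  exact zpCorank_eq_add_of_shortExact hi hf hex hfi hB

end QuasiIso

end Literature.NumberTheory.EllipticCurves
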